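import Mathlib
import Literature.MathematicalPhysics.QuantumLattice.SchwartzTensor
import Summits.QuantumFields.YangMills.Theorems.PencilRigidityCurvatureKernelBoundTensorRegularityPlaneWave
import HarnessLib

/-!
# Stub `stub_localiseOfCompact` (N2b) of line `Sketch`, crux `WeakCouplingHypercubicLimit` (reshape r15)

Helper file for crux `stmt-QuantumFields-16120` (`PencilRigidity.WeakCouplingHypercubicLimit`), line `Sketch`.
Continuum step N2b of reshape r15: a non-zero third-cumulant combination
`κ₃(f, g, h) = S₃(f⊗g⊗h) − S₁(f)S₂(g⊗h) − S₁(g)S₂(f⊗h) − S₁(h)S₂(f⊗g) + 2 S₁(f)S₁(g)S₁(h)` of a family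
`S₁` of continuous linear functionals, on a compactly supported pairwise-disjoint triple `f, g, h`, can be
LOCALISED to three balls of a common radius `ρ` whose centres are `10ρ`-separated.

Proof.  The three (compact, pairwise disjoint) supports are at mutual distance `> δ₀ > 0`
(`Disjoint.exists_cthickenings`); put `ρ := δ₀ / 10`.  The combination `κ₃` is additive in each slot
separately (`SchwartzMap.tensorFin_apply`, `map_add`).  For an additive functional `Φ` on `𝓢(E, ℂ)` and a
compactly supported `u` with `Φ u ≠ 0`, a finite smooth partition of unity `∑ᵢ χᵢ = 1` on `tsupport u`
subordinate to balls `ball xᵢ ρ` with `xᵢ ∈ tsupport u` (`SmoothPartitionOfUnity.exists_isSubordinate` on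
the model space `𝓘(ℝ, E)`) writes `u = ∑ᵢ χᵢ • u` in `𝓢(E, ℂ)` (`SchwartzMap.smulLeftCLM`,
`HasCompactSupport.hasTemperateGrowth`), so some piece `χᵢ • u`, supported in `closedBall xᵢ ρ`, has
`Φ (χᵢ • u) ≠ 0` (`Finset.exists_ne_zero_of_sum_ne_zero`).  Apply this to the first slot of `κ₃`, then to
the second, then to the third; the centres lie in the original supports, hence are `> δ₀ = 10ρ` apart.
-/

noncomputable section

open scoped SchwartzMap ContDiff Manifold
open MeasureTheory Filter Topology
open Literature.MathematicalPhysics.QuantumLattice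
open Summit.QuantumFields.YangMills.Theorems.CurvatureKernel (tensorFin_two_add_left tensorFin_two_add_right)

namespace Summit.QuantumFields.YangMills.Theorems.WeakCouplingHypercubicLimit.TraceNormColdPressure

/-! ### Additivity of `SchwartzMap.tensorFin` in each slot (one and three factors)

The two-factor versions `tensorFin_two_add_left` / `tensorFin_two_add_right` are the landed ones of
`Summit.QuantumFields.YangMills.Theorems.CurvatureKernel` (imported). -/

section TensorAdd

variable {E : Type*} [NormedAddCommGroup E] [NormedSpace ℝ E]

/-- `tensorFin 1` is additive: `(u + v)^⊗ = u^⊗ + v^⊗`. [folklore] -/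
theorem tensorFin_one_add (u v : 𝓢(E, ℂ)) :
    SchwartzMap.tensorFin 1 ![u + v] = SchwartzMap.tensorFin 1 ![u] + SchwartzMap.tensorFin 1 ![v] := by
  ext x
  simp [SchwartzMap.tensorFin_apply]

/-- `tensorFin 3` is additive in the first factor. [folklore] -/
theorem tensorFin_three_add_fst (u v g h : 𝓢(E, ℂ)) :
    SchwartzMap.tensorFin 3 ![u + v, g, h] =
      SchwartzMap.tensorFin 3 ![u, g, h] + SchwartzMap.tensorFin 3 ![v, g, h] := by
  ext x
  simp [SchwartzMap.tensorFin_apply, Fin.prod_univ_three, add_mul]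

/-- `tensorFin 3` is additive in the second factor. [folklore] -/
theorem tensorFin_three_add_snd (g u v h : 𝓢(E, ℂ)) :
    SchwartzMap.tensorFin 3 ![g, u + v, h] =
      SchwartzMap.tensorFin 3 ![g, u, h] + SchwartzMap.tensorFin 3 ![g, v, h] := by
  ext x
  simp [SchwartzMap.tensorFin_apply, Fin.prod_univ_three, add_mul, mul_add]

/-- `tensorFin 3` is additive in the third factor. [folklore] -/
theorem tensorFin_three_add_thd (g h u v : 𝓢(E, ℂ)) :
    SchwartzMap.tensorFin 3 ![g, h, u + v] =
      SchwartzMap.tensorFin 3 ![g, h, u] + SchwartzMap.tensorFin 3 ![g, h, v] := by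
  ext x
  simp [SchwartzMap.tensorFin_apply, Fin.prod_univ_three, mul_add]

end TensorAdd

/-! ### Separation of a compact set from a disjoint closed set -/

/-- A compact set and a disjoint closed set in a metric space are at distance `> δ` for some `δ > 0`
(from `Disjoint.exists_cthickenings`). [folklore] -/
theorem exists_pos_forall_lt_dist {X : Type*} [PseudoMetricSpace X] {s t : Set X} (hs : IsCompact s)
    (ht : IsClosed t) (hst : Disjoint s t) : ∃ δ : ℝ, 0 < δ ∧ ∀ x ∈ s, ∀ y ∈ t, δ < dist x y := by
  obtain ⟨δ, hδ, hdisj⟩ := hst.exists_cthickenings hs ht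
  refine ⟨δ, hδ, fun x hx y hy => ?_⟩
  by_contra hxy
  exact Set.disjoint_left.1 hdisj (Metric.self_subset_cthickening s hx)
    (Metric.mem_cthickening_of_dist_le x y δ t hy (not_lt.1 hxy))

/-! ### Localisation of an additive functional by a finite smooth partition of unity -/

/-- **Localisation in one slot.**  Let `Φ` be an additive functional on `𝓢(E, ℂ)` (`E` a
finite-dimensional real inner-product space), `u` a compactly supported Schwartz function with `Φ u ≠ 0`
and `ρ > 0`.  Then there are a Schwartz function `u'` and a point `x ∈ tsupport u` with
`tsupport u' ⊆ closedBall x ρ` and `Φ u' ≠ 0`: a finite smooth partition of unity `∑ᵢ χᵢ = 1` on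
`tsupport u` subordinate to the balls `ball xᵢ ρ`, `xᵢ ∈ tsupport u`, gives `u = ∑ᵢ χᵢ • u` in `𝓢(E, ℂ)`,
hence `∑ᵢ Φ (χᵢ • u) ≠ 0`, and some summand is non-zero. [folklore] -/
theorem exists_localised_of_map_ne_zero {E : Type*} [NormedAddCommGroup E] [InnerProductSpace ℝ E]
    [FiniteDimensional ℝ E] (Φ : 𝓢(E, ℂ) → ℂ) (hΦ : ∀ u v, Φ (u + v) = Φ u + Φ v) (u : 𝓢(E, ℂ))
    (hu : HasCompactSupport (u : E → ℂ)) (hΦu : Φ u ≠ 0) {ρ : ℝ} (hρ : 0 < ρ) :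
    ∃ (u' : 𝓢(E, ℂ)) (x : E), x ∈ tsupport (u : E → ℂ) ∧
      tsupport (u' : E → ℂ) ⊆ Metric.closedBall x ρ ∧ Φ u' ≠ 0 := by
  classical
  -- a finite cover of the support by `ρ`-balls centred in the support
  obtain ⟨t, htK, hcover⟩ := hu.elim_nhds_subcover (fun x => Metric.ball x ρ)
    (fun x _ => Metric.ball_mem_nhds x hρ)
  -- a smooth partition of unity on the support subordinate to these balls
  obtain ⟨P, hP⟩ := SmoothPartitionOfUnity.exists_isSubordinate (ι := ↥t) 𝓘(ℝ, E) (M := E)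
    (isClosed_tsupport (u : E → ℂ)) (fun i => Metric.ball (i : E) ρ) (fun _ => Metric.isOpen_ball)
    (fun y hy => by
      obtain ⟨x, hx, hyx⟩ := Set.mem_iUnion₂.1 (hcover hy)
      exact Set.mem_iUnion.2 ⟨⟨x, hx⟩, hyx⟩)
  have hsmooth : ∀ i, ContDiff ℝ ∞ (P i : E → ℝ) := fun i =>
    contMDiff_iff_contDiff.1 (P i).contMDiff
  have hcs : ∀ i, HasCompactSupport (P i : E → ℝ) := fun i =>
    IsCompact.of_isClosed_subset (isCompact_closedBall (i : E) ρ) (isClosed_tsupport _)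
      ((hP i).trans Metric.ball_subset_closedBall)
  have htemp : ∀ i, (P i : E → ℝ).HasTemperateGrowth := fun i =>
    (hcs i).hasTemperateGrowth (hsmooth i)
  -- the pieces `χᵢ • u` sum to `u`
  have hsum : ∑ i, SchwartzMap.smulLeftCLM ℂ (P i : E → ℝ) u = u := by
    ext y
    rw [sum_apply]
    simp only [SchwartzMap.smulLeftCLM_apply_apply (htemp _)]
    rw [← Finset.sum_smul]
    by_cases hy : y ∈ tsupport (u : E → ℂ)
    · rw [← finsum_eq_sum_of_fintype, P.sum_eq_one hy, one_smul]
    · rw [image_eq_zero_of_notMem_tsupport hy, smul_zero]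
  have hmap : ∀ F : ↥t → 𝓢(E, ℂ), Φ (∑ i, F i) = ∑ i, Φ (F i) := fun F =>
    map_sum (AddMonoidHom.mk' Φ hΦ) F Finset.univ
  have hne : Φ (∑ i, SchwartzMap.smulLeftCLM ℂ (P i : E → ℝ) u) ≠ 0 := by rwa [hsum]
  rw [hmap] at hne
  obtain ⟨i, -, hi⟩ := Finset.exists_ne_zero_of_sum_ne_zero hne
  refine ⟨SchwartzMap.smulLeftCLM ℂ (P i : E → ℝ) u, (i : E), htK i i.2, ?_, hi⟩
  calc tsupport ((SchwartzMap.smulLeftCLM ℂ (P i : E → ℝ) u : 𝓢(E, ℂ)) : E → ℂ)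
      ⊆ tsupport (u : E → ℂ) ∩ tsupport (P i : E → ℝ) := SchwartzMap.tsupport_smulLeftCLM_subset _ _
    _ ⊆ tsupport (P i : E → ℝ) := Set.inter_subset_right
    _ ⊆ Metric.ball (i : E) ρ := hP i
    _ ⊆ Metric.closedBall (i : E) ρ := Metric.ball_subset_closedBall

/-! ### The stub -/

/-- **Stub N2b (non-Gaussianity localises to three small, well-separated balls).**  For a family `S₁`
of continuous linear functionals on the `n`-point Schwartz spaces over `ℝ⁴` and compactly supported
complex tests `f, g, h` of pairwise disjoint topological supports on which the third-cumulant combination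
`κ₃ = S₃ − S₁S₂ − S₁S₂ − S₁S₂ + 2 S₁S₁S₁` (canonical tensor witnesses `SchwartzMap.tensorFin`) is
non-zero, there are tests `f', g', h'` supported in closed balls of a common radius `ρ > 0` about centres
`p, q, w` at mutual distance `≥ 10ρ` on which `κ₃` is still non-zero.  The supports are `> δ₀`-separated
for some `δ₀ > 0`; with `ρ := δ₀ / 10`, localise slot by slot (`κ₃` is additive in each slot) by finite
smooth partitions of unity subordinate to `ρ`-balls centred in the supports. [folklore] -/
theorem stub_localiseOfCompact :
    ∀ (S₁ : SchwingerFamily (EuclideanSpace ℝ (Fin 4))) (f g h : 𝓢(EuclideanSpace ℝ (Fin 4), ℂ)),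
      HasCompactSupport (f : EuclideanSpace ℝ (Fin 4) → ℂ) → HasCompactSupport (g : EuclideanSpace ℝ (Fin 4) → ℂ) →
      HasCompactSupport (h : EuclideanSpace ℝ (Fin 4) → ℂ) →
      Disjoint (tsupport (f : EuclideanSpace ℝ (Fin 4) → ℂ)) (tsupport (g : EuclideanSpace ℝ (Fin 4) → ℂ)) →
      Disjoint (tsupport (f : EuclideanSpace ℝ (Fin 4) → ℂ)) (tsupport (h : EuclideanSpace ℝ (Fin 4) → ℂ)) →
      Disjoint (tsupport (g : EuclideanSpace ℝ (Fin 4) → ℂ)) (tsupport (h : EuclideanSpace ℝ (Fin 4) → ℂ)) →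
      S₁ 3 (SchwartzMap.tensorFin 3 ![f, g, h]) -
            S₁ 1 (SchwartzMap.tensorFin 1 ![f]) * S₁ 2 (SchwartzMap.tensorFin 2 ![g, h]) -
          S₁ 1 (SchwartzMap.tensorFin 1 ![g]) * S₁ 2 (SchwartzMap.tensorFin 2 ![f, h]) -
          S₁ 1 (SchwartzMap.tensorFin 1 ![h]) * S₁ 2 (SchwartzMap.tensorFin 2 ![f, g]) +
          2 * (S₁ 1 (SchwartzMap.tensorFin 1 ![f]) * S₁ 1 (SchwartzMap.tensorFin 1 ![g]) *
            S₁ 1 (SchwartzMap.tensorFin 1 ![h])) ≠ 0 →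
      ∃ (f' g' h' : 𝓢(EuclideanSpace ℝ (Fin 4), ℂ)) (p q w : EuclideanSpace ℝ (Fin 4)) (ρ : ℝ), 0 < ρ ∧
        tsupport (f' : EuclideanSpace ℝ (Fin 4) → ℂ) ⊆ Metric.closedBall p ρ ∧
        tsupport (g' : EuclideanSpace ℝ (Fin 4) → ℂ) ⊆ Metric.closedBall q ρ ∧
        tsupport (h' : EuclideanSpace ℝ (Fin 4) → ℂ) ⊆ Metric.closedBall w ρ ∧
        10 * ρ ≤ dist p q ∧ 10 * ρ ≤ dist p w ∧ 10 * ρ ≤ dist q w ∧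
        S₁ 3 (SchwartzMap.tensorFin 3 ![f', g', h']) -
            S₁ 1 (SchwartzMap.tensorFin 1 ![f']) * S₁ 2 (SchwartzMap.tensorFin 2 ![g', h']) -
          S₁ 1 (SchwartzMap.tensorFin 1 ![g']) * S₁ 2 (SchwartzMap.tensorFin 2 ![f', h']) -
          S₁ 1 (SchwartzMap.tensorFin 1 ![h']) * S₁ 2 (SchwartzMap.tensorFin 2 ![f', g']) +
          2 * (S₁ 1 (SchwartzMap.tensorFin 1 ![f']) * S₁ 1 (SchwartzMap.tensorFin 1 ![g']) *
            S₁ 1 (SchwartzMap.tensorFin 1 ![h'])) ≠ 0 := by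
  intro S₁ f g h hf hg hh hfg hfh hgh hne
  -- Step 1: separation of the supports and the radius `ρ`
  obtain ⟨δ₁, hδ₁, hd₁⟩ := exists_pos_forall_lt_dist hf (isClosed_tsupport _) hfg
  obtain ⟨δ₂, hδ₂, hd₂⟩ := exists_pos_forall_lt_dist hf (isClosed_tsupport _) hfh
  obtain ⟨δ₃, hδ₃, hd₃⟩ := exists_pos_forall_lt_dist hg (isClosed_tsupport _) hgh
  obtain ⟨ρ, hρ, hρ₁, hρ₂, hρ₃⟩ : ∃ ρ : ℝ, 0 < ρ ∧ 10 * ρ ≤ δ₁ ∧ 10 * ρ ≤ δ₂ ∧ 10 * ρ ≤ δ₃ := by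
    refine ⟨min δ₁ (min δ₂ δ₃) / 10, by positivity, ?_, ?_, ?_⟩
    · linarith [min_le_left δ₁ (min δ₂ δ₃)]
    · linarith [min_le_right δ₁ (min δ₂ δ₃), min_le_left δ₂ δ₃]
    · linarith [min_le_right δ₁ (min δ₂ δ₃), min_le_right δ₂ δ₃]
  -- Step 2: the third-cumulant combination and its additivity in each slot
  let κ : 𝓢(EuclideanSpace ℝ (Fin 4), ℂ) → 𝓢(EuclideanSpace ℝ (Fin 4), ℂ) →
      𝓢(EuclideanSpace ℝ (Fin 4), ℂ) → ℂ := fun u v w =>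
    S₁ 3 (SchwartzMap.tensorFin 3 ![u, v, w]) -
          S₁ 1 (SchwartzMap.tensorFin 1 ![u]) * S₁ 2 (SchwartzMap.tensorFin 2 ![v, w]) -
        S₁ 1 (SchwartzMap.tensorFin 1 ![v]) * S₁ 2 (SchwartzMap.tensorFin 2 ![u, w]) -
        S₁ 1 (SchwartzMap.tensorFin 1 ![w]) * S₁ 2 (SchwartzMap.tensorFin 2 ![u, v]) +
        2 * (S₁ 1 (SchwartzMap.tensorFin 1 ![u]) * S₁ 1 (SchwartzMap.tensorFin 1 ![v]) *
          S₁ 1 (SchwartzMap.tensorFin 1 ![w]))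
  have hadd₁ : ∀ v w u u' : 𝓢(EuclideanSpace ℝ (Fin 4), ℂ), κ (u + u') v w = κ u v w + κ u' v w := by
    intro v w u u'
    simp only [κ, tensorFin_three_add_fst, tensorFin_two_add_left, tensorFin_one_add, map_add]
    ring
  have hadd₂ : ∀ u w v v' : 𝓢(EuclideanSpace ℝ (Fin 4), ℂ), κ u (v + v') w = κ u v w + κ u v' w := by
    intro u w v v'
    simp only [κ, tensorFin_three_add_snd, tensorFin_two_add_left, tensorFin_two_add_right,
      tensorFin_one_add, map_add]
    ring
  have hadd₃ : ∀ u v w w' : 𝓢(EuclideanSpace ℝ (Fin 4), ℂ), κ u v (w + w') = κ u v w + κ u v w' := by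
    intro u v w w'
    simp only [κ, tensorFin_three_add_thd, tensorFin_two_add_right, tensorFin_one_add, map_add]
    ring
  have hκ : κ f g h ≠ 0 := hne
  -- Step 3: localise slot by slot
  obtain ⟨f', p, hp, hf', hne₁⟩ :=
    exists_localised_of_map_ne_zero (fun u => κ u g h) (hadd₁ g h) f hf hκ hρ
  obtain ⟨g', q, hq, hg', hne₂⟩ :=
    exists_localised_of_map_ne_zero (fun v => κ f' v h) (hadd₂ f' h) g hg hne₁ hρ
  obtain ⟨h', w, hw, hh', hne₃⟩ :=
    exists_localised_of_map_ne_zero (fun w => κ f' g' w) (hadd₃ f' g') h hh hne₂ hρ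
  refine ⟨f', g', h', p, q, w, ρ, hρ, hf', hg', hh', ?_, ?_, ?_, hne₃⟩
  · exact hρ₁.trans (hd₁ p hp q hq).le
  · exact hρ₂.trans (hd₂ p hp w hw).le
  · exact hρ₃.trans (hd₃ q hq w hw).le

end Summit.QuantumFields.YangMills.Theorems.WeakCouplingHypercubicLimit.TraceNormColdPressure
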